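/-
Copyright: the b2b-balaban T⁴-continuum CRUX team, row NE7b leaf lineage `t4-ne7b-formalise-leaf-03` (gen 140). Project licence.
-/
import Summits.QuantumFields.BalabanUV.T4Continuum.Spine.NE7b.TiltedMeanNearMinimiser
import Mathlib.Analysis.InnerProductSpace.Calculus
import Literature.Analysis.FunctionSpaces.BochnerProofs

/-!
# SUPPLIERS for `…TiltedMeanNearMinimiser`: the displayed integrabilities from the two-sided first-order letters, the gradient
# growth `‖∇V x‖ ≤ Λ‖x − x₀‖`, and the centring letter DISCHARGED down to `(λ, Λ, ∇V x₀ = 0)`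
# (row NE7b, node U5c; kernel lemmas of real analysis)

Cell `pub-balaban`, sub-cell `t4`, spine estimate NE7b (`T4WeightBudget.RelWeightBound`; the cell's OWN estimate — NOT PRINTED in
[Bałaban 1983–89], NOT PROVED).  Crux-route work under `Spine/NE7b/` by a row leaf on the convexity road; NOTHING of Bałaban's is named
or asserted; no `T4Continuum/Support` leaf typed; no `def`; zero `sorry`.

WHY.  `…TiltedMeanNearMinimiser.abs_tiltedMean_inner_sub_le` displays four integrabilities (`e^{−V}`, `‖x − x₀‖e^{−V}`, `‖x − x₀‖²e^{−V}`,
`‖x − x₀‖·‖∇V x‖·e^{−V}`).  Under the lower pinch at the critical point (a consequence of the road's `λ`-letter) the first three follow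
by Gaussian domination (`Literature.Analysis.FunctionSpaces.integrable_rexp_neg_mul_sq_norm`, the tree's Gaussian weight); the fourth
needs a growth letter for `∇V`, supplied here from the UPPER first-order letter (`Λ`-smoothness) by the co-coercivity argument
`‖∇V x‖ ≤ Λ‖x − x₀‖`.

WHAT IS PROVED ([folklore]): `integrable_exp_neg_of_lowerPinch`, `integrable_norm_sq_mul_exp_neg_of_lowerPinch` (`t² ≤ (4∕λ)e^{λt²∕4}`),
`integrable_norm_mul_exp_neg_of_lowerPinch` (`t ≤ 1 + t²`), **`norm_gradient_le_of_twoSided`** (test the upper letter at `y = x − ∇V x∕Λ`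
and at `(x₀, x)`; `x₀` minimises), and the discharged END **`abs_tiltedMean_inner_sub_le_of_twoSided`**: `0 < λ`, `0 < Λ`,
`Differentiable ℝ V`, the two first-order letters, `∇V x₀ = 0` ⊢ `|∫⟪u, x⟫dν_V − ⟪u, x₀⟫| ≤ ‖u‖·√(n∕λ)`; a non-vacuity `example`
(`V = ½‖x‖²`, `λ = Λ = 1`, `x₀ = 0`, any `n`, any `u`).

NOT HERE (honest): the (A1c) identification of `V, λ, Λ, x₀` with print's objects; anything of Bałaban's.  NE7b NOT PRINTED ∕ NOT PROVED;
spine PROVED 0∕9; rung (B)+1 on a FINITE torus — NOT infinite volume, NOT the mass gap, NOT Clay.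
HONEST DEPENDENCY: continuum YM on T⁴ ⇐ BetaPertH ∧ nine spine estimates (0/9 proved); BetaPertH ⇐ (D1) ∧ (D4) ∧ CAP+tail; G-an2-4
gates asym, D1 and NE2/3/4.
-/

set_option autoImplicit false

noncomputable section

open MeasureTheory Real InnerProductSpace
open scoped RealInnerProductSpace

namespace Summit.QuantumFields.BalabanUV.T4Continuum.NE7b.TiltedMeanNearMinimiserSuppliers

open Summit.QuantumFields.BalabanUV.T4Continuum.NE7b.TiltedMeanNearMinimiser

variable {n : ℕ}

/-! ## §1 Integrabilities from the lower pinch -/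

/-- `e^{−V}` is integrable under the lower pinch `V x₀ + (λ∕2)‖y − x₀‖² ≤ V y` (`λ > 0`, `V` continuous): Gaussian domination.
[folklore] -/
theorem integrable_exp_neg_of_lowerPinch {V : EuclideanSpace ℝ (Fin n) → ℝ} {lam : ℝ} (hlam : 0 < lam) (hVc : Continuous V)
    (x₀ : EuclideanSpace ℝ (Fin n)) (hlow : ∀ y, V x₀ + lam / 2 * ‖y - x₀‖ ^ 2 ≤ V y) :
    Integrable fun x => exp (-V x) := by
  have hb : 0 < lam / 2 := by positivity
  have hGi : Integrable fun y : EuclideanSpace ℝ (Fin n) => exp (-V x₀) * exp (-(lam / 2) * ‖y - x₀‖ ^ 2) :=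
    ((Literature.Analysis.FunctionSpaces.integrable_rexp_neg_mul_sq_norm hb).comp_sub_right x₀).const_mul _
  refine hGi.mono' (continuous_exp.comp hVc.neg).aestronglyMeasurable (ae_of_all _ fun y => ?_)
  rw [norm_of_nonneg (exp_pos _).le, ← exp_add]
  exact exp_le_exp.2 (by nlinarith [hlow y])

/-- `‖x − x₀‖²e^{−V}` is integrable under the lower pinch (`t² ≤ (4∕λ)e^{λt²∕4}`, then Gaussian domination with rate `λ∕4`). [folklore] -/
theorem integrable_norm_sq_mul_exp_neg_of_lowerPinch {V : EuclideanSpace ℝ (Fin n) → ℝ} {lam : ℝ} (hlam : 0 < lam)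
    (hVc : Continuous V) (x₀ : EuclideanSpace ℝ (Fin n)) (hlow : ∀ y, V x₀ + lam / 2 * ‖y - x₀‖ ^ 2 ≤ V y) :
    Integrable fun x => ‖x - x₀‖ ^ 2 * exp (-V x) := by
  have hb : 0 < lam / 4 := by positivity
  have hGi : Integrable fun y : EuclideanSpace ℝ (Fin n) => (4 / lam * exp (-V x₀)) * exp (-(lam / 4) * ‖y - x₀‖ ^ 2) :=
    ((Literature.Analysis.FunctionSpaces.integrable_rexp_neg_mul_sq_norm hb).comp_sub_right x₀).const_mul _
  refine hGi.mono' (((continuous_id.sub continuous_const).norm.pow 2).mul (continuous_exp.comp hVc.neg)).aestronglyMeasurable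
    (ae_of_all _ fun y => ?_)
  rw [norm_mul, norm_pow, norm_norm, norm_of_nonneg (exp_pos _).le]
  -- `t² ≤ (4∕λ)·e^{λt²∕4}`
  have ht : ‖y - x₀‖ ^ 2 ≤ 4 / lam * exp (lam / 4 * ‖y - x₀‖ ^ 2) := by
    have h1 : lam / 4 * ‖y - x₀‖ ^ 2 + 1 ≤ exp (lam / 4 * ‖y - x₀‖ ^ 2) := add_one_le_exp _
    rw [div_mul_eq_mul_div, le_div_iff₀ hlam]
    nlinarith
  have hV' : exp (-V y) ≤ exp (-V x₀) * exp (-(lam / 2) * ‖y - x₀‖ ^ 2) := by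
    rw [← exp_add]; exact exp_le_exp.2 (by nlinarith [hlow y])
  calc ‖y - x₀‖ ^ 2 * exp (-V y)
      ≤ (4 / lam * exp (lam / 4 * ‖y - x₀‖ ^ 2)) * (exp (-V x₀) * exp (-(lam / 2) * ‖y - x₀‖ ^ 2)) :=
        mul_le_mul ht hV' (exp_pos _).le (by positivity)
    _ = (4 / lam * exp (-V x₀)) * exp (-(lam / 4) * ‖y - x₀‖ ^ 2) := by
        have e : exp (lam / 4 * ‖y - x₀‖ ^ 2) * exp (-(lam / 2) * ‖y - x₀‖ ^ 2) = exp (-(lam / 4) * ‖y - x₀‖ ^ 2) := by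
          rw [← exp_add]; ring_nf
        calc (4 / lam * exp (lam / 4 * ‖y - x₀‖ ^ 2)) * (exp (-V x₀) * exp (-(lam / 2) * ‖y - x₀‖ ^ 2))
            = (4 / lam * exp (-V x₀)) * (exp (lam / 4 * ‖y - x₀‖ ^ 2) * exp (-(lam / 2) * ‖y - x₀‖ ^ 2)) := by ring
          _ = (4 / lam * exp (-V x₀)) * exp (-(lam / 4) * ‖y - x₀‖ ^ 2) := by rw [e]

/-- `‖x − x₀‖e^{−V}` is integrable under the lower pinch (`t ≤ 1 + t²`). [folklore] -/
theorem integrable_norm_mul_exp_neg_of_lowerPinch {V : EuclideanSpace ℝ (Fin n) → ℝ} {lam : ℝ} (hlam : 0 < lam)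
    (hVc : Continuous V) (x₀ : EuclideanSpace ℝ (Fin n)) (hlow : ∀ y, V x₀ + lam / 2 * ‖y - x₀‖ ^ 2 ≤ V y) :
    Integrable fun x => ‖x - x₀‖ * exp (-V x) := by
  refine ((integrable_exp_neg_of_lowerPinch hlam hVc x₀ hlow).add
    (integrable_norm_sq_mul_exp_neg_of_lowerPinch hlam hVc x₀ hlow)).mono'
    (((continuous_id.sub continuous_const).norm).mul (continuous_exp.comp hVc.neg)).aestronglyMeasurable
    (ae_of_all _ fun y => ?_)
  rw [norm_mul, norm_norm, norm_of_nonneg (exp_pos _).le]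
  show ‖y - x₀‖ * exp (-V y) ≤ exp (-V y) + ‖y - x₀‖ ^ 2 * exp (-V y)
  nlinarith [exp_pos (-V y), norm_nonneg (y - x₀), sq_nonneg (‖y - x₀‖ - 1)]

/-! ## §2 Gradient growth and the discharged END -/

/-- **GRADIENT GROWTH FROM THE TWO-SIDED LETTERS** (co-coercivity): the lower letter (`λ ≥ 0` suffices) at a critical point `x₀` and the
upper letter `V y ≤ V x + ⟪∇V x, y − x⟫ + (Λ∕2)‖y − x‖²` (`Λ > 0`) give `‖∇V x‖ ≤ Λ‖x − x₀‖` (test the upper letter at `y = x − ∇V x∕Λ`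
and at `(x₀, x)`; `x₀` minimises). [folklore] -/
theorem norm_gradient_le_of_twoSided {V : EuclideanSpace ℝ (Fin n) → ℝ} {lam Lam : ℝ} {x₀ : EuclideanSpace ℝ (Fin n)}
    (hlam : 0 ≤ lam) (hLam : 0 < Lam)
    (hV : ∀ x y : EuclideanSpace ℝ (Fin n), V x + ⟪gradient V x, y - x⟫ + lam / 2 * ‖y - x‖ ^ 2 ≤ V y)
    (hVup : ∀ x y : EuclideanSpace ℝ (Fin n), V y ≤ V x + ⟪gradient V x, y - x⟫ + Lam / 2 * ‖y - x‖ ^ 2)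
    (hcrit : gradient V x₀ = 0) (x : EuclideanSpace ℝ (Fin n)) : ‖gradient V x‖ ≤ Lam * ‖x - x₀‖ := by
  set g := gradient V x with hg
  -- the minimiser property at `x − g∕Λ`, the upper letter at `(x, x − g∕Λ)` and at `(x₀, x)`
  have hmin : V x₀ ≤ V (x - Lam⁻¹ • g) := by
    have h := hV x₀ (x - Lam⁻¹ • g)
    rw [hcrit, inner_zero_left, add_zero] at h
    nlinarith [norm_nonneg (x - Lam⁻¹ • g - x₀)]
  have hdesc : V (x - Lam⁻¹ • g) ≤ V x - ‖g‖ ^ 2 / (2 * Lam) := by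
    have h := hVup x (x - Lam⁻¹ • g)
    have e1 : x - Lam⁻¹ • g - x = -(Lam⁻¹ • g) := by abel
    rw [e1, inner_neg_right, real_inner_smul_right, real_inner_self_eq_norm_sq, norm_neg, norm_smul,
      norm_inv, norm_of_nonneg hLam.le] at h
    have e2 : V x + -(Lam⁻¹ * ‖g‖ ^ 2) + Lam / 2 * (Lam⁻¹ * ‖g‖) ^ 2 = V x - ‖g‖ ^ 2 / (2 * Lam) := by
      field_simp; ring
    linarith [e2]
  have hup0 : V x ≤ V x₀ + Lam / 2 * ‖x - x₀‖ ^ 2 := by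
    have h := hVup x₀ x
    rwa [hcrit, inner_zero_left, add_zero] at h
  have hsq : ‖g‖ ^ 2 ≤ (Lam * ‖x - x₀‖) ^ 2 := by
    have h1 : ‖g‖ ^ 2 / (2 * Lam) ≤ Lam / 2 * ‖x - x₀‖ ^ 2 := by linarith
    rw [div_le_iff₀ (by positivity)] at h1
    nlinarith
  exact (pow_le_pow_iff_left₀ (norm_nonneg _) (by positivity) two_ne_zero).mp hsq

/-- **THE CENTRING LETTER, DISCHARGED FROM THE TWO-SIDED LETTERS**: for `V` differentiable with the road's first-order `λ`-convexity
letter (`λ > 0`), the upper first-order letter (`Λ`-smoothness, `Λ > 0`) and a critical point `∇V x₀ = 0` (supplied by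
`…ConvexMinimiser.exists_gradient_eq_zero_of_firstOrder`), EVERY integrability above is automatic and
`|∫⟪u, x⟫ dν_V − ⟪u, x₀⟫| ≤ ‖u‖·√(n∕λ)`. [folklore] -/
theorem abs_tiltedMean_inner_sub_le_of_twoSided {V : EuclideanSpace ℝ (Fin n) → ℝ} {lam Lam : ℝ} {x₀ : EuclideanSpace ℝ (Fin n)}
    (hlam : 0 < lam) (hLam : 0 < Lam) (hVd : Differentiable ℝ V)
    (hV : ∀ x y : EuclideanSpace ℝ (Fin n), V x + ⟪gradient V x, y - x⟫ + lam / 2 * ‖y - x‖ ^ 2 ≤ V y)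
    (hVup : ∀ x y : EuclideanSpace ℝ (Fin n), V y ≤ V x + ⟪gradient V x, y - x⟫ + Lam / 2 * ‖y - x‖ ^ 2)
    (hcrit : gradient V x₀ = 0) (u : EuclideanSpace ℝ (Fin n)) :
    |∫ x, ⟪u, x⟫ ∂(volume.tilted fun x => -V x) - ⟪u, x₀⟫| ≤ ‖u‖ * Real.sqrt (n / lam) := by
  have hlow : ∀ y, V x₀ + lam / 2 * ‖y - x₀‖ ^ 2 ≤ V y := fun y => by
    have h := hV x₀ y
    rwa [hcrit, inner_zero_left, add_zero] at h
  have hVc := hVd.continuous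
  have hZ := integrable_exp_neg_of_lowerPinch hlam hVc x₀ hlow
  have hM := integrable_norm_mul_exp_neg_of_lowerPinch hlam hVc x₀ hlow
  have hM2 := integrable_norm_sq_mul_exp_neg_of_lowerPinch hlam hVc x₀ hlow
  have hG : Integrable fun x => ‖x - x₀‖ * (‖gradient V x‖ * exp (-V x)) := by
    refine (hM2.const_mul Lam).mono' ?_ (ae_of_all _ fun x => ?_)
    · have hgm : Measurable fun x => ‖gradient V x‖ := by
        have e : (fun x => ‖gradient V x‖) = fun x => ‖fderiv ℝ V x‖ := by
          funext x; rw [gradient, LinearIsometryEquiv.norm_map]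
        rw [e]; exact (measurable_fderiv ℝ V).norm
      exact (((continuous_id.sub continuous_const).norm.measurable).mul
        (hgm.mul (continuous_exp.comp hVc.neg).measurable)).aestronglyMeasurable
    · rw [norm_mul, norm_mul, norm_norm, norm_norm, norm_of_nonneg (exp_pos _).le]
      have hg := norm_gradient_le_of_twoSided hlam.le hLam hV hVup hcrit x
      have h3 : ‖x - x₀‖ * exp (-V x) * ‖gradient V x‖ ≤ ‖x - x₀‖ * exp (-V x) * (Lam * ‖x - x₀‖) :=
        mul_le_mul_of_nonneg_left hg (mul_nonneg (norm_nonneg _) (exp_pos _).le)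
      calc ‖x - x₀‖ * (‖gradient V x‖ * exp (-V x)) = ‖x - x₀‖ * exp (-V x) * ‖gradient V x‖ := by ring
        _ ≤ ‖x - x₀‖ * exp (-V x) * (Lam * ‖x - x₀‖) := h3
        _ = Lam * (‖x - x₀‖ ^ 2 * exp (-V x)) := by ring
  exact abs_tiltedMean_inner_sub_le hlam hVd hV hcrit hZ hM hM2 hG u

/-- Non-vacuity toy: every hypothesis of `abs_tiltedMean_inner_sub_le_of_twoSided` is jointly inhabited — `V = ½‖x‖²`,
`λ = Λ = 1`, `x₀ = 0`, any `n`, any `u` (both letters hold with equality; `∇V x = x`). -/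
example (u : EuclideanSpace ℝ (Fin n)) :
    |∫ x, ⟪u, x⟫ ∂(volume.tilted fun x : EuclideanSpace ℝ (Fin n) => -(1 / 2 * ‖x‖ ^ 2)) - ⟪u, (0 : EuclideanSpace ℝ (Fin n))⟫| ≤
      ‖u‖ * Real.sqrt (n / 1) := by
  have hgrad : ∀ x : EuclideanSpace ℝ (Fin n), gradient (fun x : EuclideanSpace ℝ (Fin n) => 1 / 2 * ‖x‖ ^ 2) x = x := by
    intro x
    have h1 : HasFDerivAt (fun x : EuclideanSpace ℝ (Fin n) => ‖x‖ ^ 2) (2 • innerSL ℝ x) x :=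
      (hasStrictFDerivAt_norm_sq x).hasFDerivAt
    have h2 := (h1.const_mul (1 / 2 : ℝ)).hasGradientAt
    rw [h2.gradient]
    refine ext_inner_right ℝ fun v => ?_
    rw [InnerProductSpace.toDual_symm_apply]
    simp only [FunLike.coe_smul, Pi.smul_apply, smul_eq_mul, nsmul_eq_mul]
    show 1 / 2 * (2 * ⟪x, v⟫) = ⟪x, v⟫
    ring
  have hdiff : Differentiable ℝ fun x : EuclideanSpace ℝ (Fin n) => 1 / 2 * ‖x‖ ^ 2 :=
    fun x => (((hasStrictFDerivAt_norm_sq x).hasFDerivAt).const_mul (1 / 2 : ℝ)).differentiableAt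
  have hletter : ∀ x y : EuclideanSpace ℝ (Fin n),
      1 / 2 * ‖x‖ ^ 2 + ⟪x, y - x⟫ + 1 / 2 * ‖y - x‖ ^ 2 = 1 / 2 * ‖y‖ ^ 2 := by
    intro x y
    have h := norm_sub_sq_real y x
    rw [real_inner_comm] at h
    have e : ⟪x, y - x⟫ = ⟪x, y⟫ - ‖x‖ ^ 2 := by rw [inner_sub_right, real_inner_self_eq_norm_sq]
    rw [e]; linarith
  refine abs_tiltedMean_inner_sub_le_of_twoSided (lam := 1) (Lam := 1) one_pos one_pos hdiff ?_ ?_ ?_ u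
  · intro x y; rw [hgrad x, hletter x y]
  · intro x y; rw [hgrad x, hletter x y]
  · rw [hgrad]


end Summit.QuantumFields.BalabanUV.T4Continuum.NE7b.TiltedMeanNearMinimiserSuppliers

end
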